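import Summits.CriticalPhenomena.PercolationContinuityZ3.Theorems.Transplant.SkelPhiRootKitClauseG
import Summits.CriticalPhenomena.PercolationContinuityZ3.Theorems.Transplant.SkelPhiStepINegFrame
import HarnessLib

/-!
# N1 (the `{±1}` node), (R) column ((R6a′); (L3)): **THE EXIT TABLES ARE SERVED EVENTS** — every entry of p1-g11's orientation-aware piece tables (`pexRaw`, `pexLev`, hence
# `pexXO`/`pexYO`/`pexRO`) at a centre `c` IS one of the eight realised Step-I″ pieces `pieceNAt G φK D t c M n fam σ' τ'` of the kit pair `(M, n)` in its own orientation
# `φK = oriφ φ (Q.oS c)` (`pexRaw_eq_pieceNAt`, `pexLev_eq_pieceNAt`), and the short prism `RgO` is the realised region `regionNAt` (`coe_RgO_eq_regionNAt`); so the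
# `hexit` hypotheses of the kit clauses (`1 − δ² < P_q(linkIn ↑(RgO Q c) (Λ c k) (table … i σ₀ c))`) follow from the served inputs at `c` over ALL `(fam, σ', τ')`
# (`real_pexXO_gt`, `real_pexYO_gt`, `real_pexRO_gt`) — the consumer never inspects the table

builds on p205010 (kernel theorem, internal audit signed; external expert review pending) — nothing in this file uses p205010; nothing here is a claim about the open node.
Lane `prim-bschramm`, seat `prim-bschramm-p3` (gen 9; design owner + (R) owner); helper file (`--supports stmt-CriticalPhenomena-4575 --as helper`).
[cite: KozmaNitzan2024, §4 pp. 19–21 ((21)–(25))] [cite: MartineauTassion2017, §3.2]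
-/

noncomputable section

open scoped Classical

namespace Summit.CriticalPhenomena.PercolationContinuityZ3.Theorems.Transplant

namespace Skelφ

open MeasureTheory Literature.Probability.Percolation Literature.Probability.LatticeModels SimpleGraph KNLevels
open StepI (DataN pieceNAt regionNAt)

variable {V : Type} {G : SimpleGraph V} [G.LocallyFinite] {φ : V → Site 2}

/-! ## §1 Table entries are realised pieces -/

section Pieces

variable {Q : ShortPcO V} {D : DataN V} {t c : V} {M n : ℕ}
  (hn : Q.nS c = n) (hh : Q.hS c = D.hgt t M n) (hℓ : Q.ℓS c = D.len t M n) (hR : Q.RS c = D.R (D.scale t M n))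
include hn hh hℓ hR

/-- **The short prism is the realised link region.** [folklore] -/
theorem coe_RgO_eq_regionNAt : (↑(RgO G φ Q c) : Set V) = regionNAt G (oriφ φ (Q.oS c)) D t c M n := by
  subst hn
  unfold RgO regionNAt
  rw [← hh, ← hℓ, ← hR]
  exact StepI.coe_pgramPrismFin (G := G) (φ := oriφ φ (Q.oS c)) c _ _ _ _

/-- **Every raw-side table entry is a realised piece** of the kit pair in its own orientation. [this work] -/
theorem pexRaw_eq_pieceNAt (hv : Q.vS c = D.spl t M n) (Mz : ℕ) {e : ℤ} (he : e = 1 ∨ e = -1) :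
    ∃ (fam : Fin 2) (σ' τ' : ℤˣ), pexRaw G φ Q Mz e c = pieceNAt G (oriφ φ (Q.oS c)) D t c M n fam σ' τ' := by
  have hes : e * sgnz (Q.hS c) = 1 ∨ e * sgnz (Q.hS c) = -1 := by
    rcases he with rfl | rfl <;> rcases sgnz_cases (Q.hS c) with h | h <;> simp [h]
  unfold pexRaw
  cases hQ : Q.oS c
  · simp only [Bool.false_eq_true, if_false, oriφ_false]
    split_ifs
    · refine ⟨0, sgnU (e * sgnz (Q.hS c)), sgnU e, ?_⟩
      unfold pieceNAt; rw [if_pos rfl, val_sgnU hes, val_sgnU he, hn, hh, hℓ, hR]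
    · refine ⟨1, sgnU e, 1, ?_⟩
      unfold pieceNAt; rw [if_neg (by decide), val_sgnU he, Units.val_one, hn, hh, hℓ, hR, hv]
  · simp only [if_true, oriφ_true]
    refine ⟨0, sgnU e, 1, ?_⟩
    unfold pieceNAt; rw [if_pos rfl, val_sgnU he, Units.val_one, hn, hh, hℓ, hR]

/-- **Every level-side table entry is a realised piece** of the kit pair in its own orientation. [this work] -/
theorem pexLev_eq_pieceNAt (hv : Q.vS c = D.spl t M n) (nL : ℕ) (hL A : ℤ) {e : ℤ} (he : e = 1 ∨ e = -1) :
    ∃ (fam : Fin 2) (σ' τ' : ℤˣ), pexLev G φ Q nL hL A e c = pieceNAt G (oriφ φ (Q.oS c)) D t c M n fam σ' τ' := by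
  have hsg : ∀ x : ℤ, e * sgnz x = 1 ∨ e * sgnz x = -1 := fun x => by
    rcases he with rfl | rfl <;> rcases sgnz_cases x with h | h <;> simp [h]
  have hsg' : ∀ x : ℤ, -e * sgnz x = 1 ∨ -e * sgnz x = -1 := fun x => by
    rcases he with rfl | rfl <;> rcases sgnz_cases x with h | h <;> simp [h]
  unfold pexLev
  cases hQ : Q.oS c
  · simp only [Bool.false_eq_true, if_false, oriφ_false]
    split_ifs
    · refine ⟨0, sgnU (e * sgnz ((nL : ℤ) * Q.nS c - hL * Q.hS c)), sgnU (-e * sgnz hL), ?_⟩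
      unfold pieceNAt; rw [if_pos rfl, val_sgnU (hsg _), val_sgnU (hsg' _), hn, hh, hℓ, hR]
    · refine ⟨1, sgnU (-e * sgnz hL), 1, ?_⟩
      unfold pieceNAt; rw [if_neg (by decide), val_sgnU (hsg' _), Units.val_one, hn, hh, hℓ, hR, hv]
  · simp only [if_true, oriφ_true]
    split_ifs
    · refine ⟨0, sgnU (e * sgnz ((nL : ℤ) * Q.hS c - hL * Q.nS c)), sgnU e, ?_⟩
      unfold pieceNAt; rw [if_pos rfl, val_sgnU (hsg _), val_sgnU he, hn, hh, hℓ, hR]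
    · refine ⟨1, sgnU e, 1, ?_⟩
      unfold pieceNAt; rw [if_neg (by decide), val_sgnU he, Units.val_one, hn, hh, hℓ, hR, hv]

end Pieces

/-! ## §2 The `hexit` hypotheses from the served inputs -/

section Served

variable {Q : ShortPcO V} {D : DataN V} {t : V} {M n : ℕ} {q : unitInterval} {δ : ℝ} {Λ : V → ℕ → Finset V} {k : ℕ}
  (hQ : ∀ c, Q.nS c = n ∧ Q.hS c = D.hgt t M n ∧ Q.ℓS c = D.len t M n ∧ Q.RS c = D.R (D.scale t M n) ∧ Q.vS c = D.spl t M n)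
  (hserved : ∀ (c : V) (fam : Fin 2) (σ' τ' : ℤˣ), 1 - δ < (bondPercolation G q).real
    (linkIn (regionNAt G (oriφ φ (Q.oS c)) D t c M n) (Λ c k) (pieceNAt G (oriφ φ (Q.oS c)) D t c M n fam σ' τ')))
include hQ hserved

/-- **`hexit` for the x-run table** from the served inputs at every centre. [cite: KozmaNitzan2024, §4 pp. 19–21] -/
theorem real_pexXO_gt (Mz nL : ℕ) (hL A : ℤ) {σ : ℤ} (hσ : σ = 1 ∨ σ = -1) :
    ∀ (c : V) (i : Fin 2) (σ₀ : ℤˣ), 1 - δ < (bondPercolation G q).real (linkIn (↑(RgO G φ Q c) : Set V) (Λ c k) (pexXO G φ Q Mz nL hL A σ i σ₀ c)) := by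
  intro c i σ₀
  obtain ⟨hn, hh, hℓ, hR, hv⟩ := hQ c
  have he : (σ₀ : ℤ) * σ = 1 ∨ (σ₀ : ℤ) * σ = -1 := by
    rcases Int.units_eq_one_or σ₀ with h | h <;> rcases hσ with h' | h' <;> simp [h, h']
  rw [coe_RgO_eq_regionNAt hn hh hℓ hR]
  unfold pexXO
  split_ifs
  · obtain ⟨fam, σ', τ', hp⟩ := pexRaw_eq_pieceNAt (G := G) (φ := φ) hn hh hℓ hR hv Mz he
    rw [hp]; exact hserved c fam σ' τ'
  · obtain ⟨fam, σ', τ', hp⟩ := pexLev_eq_pieceNAt (G := G) (φ := φ) hn hh hℓ hR hv nL hL A he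
    rw [hp]; exact hserved c fam σ' τ'

/-- **`hexit` for the y′-run table** from the served inputs at every centre. [cite: KozmaNitzan2024, §4 pp. 19–21] -/
theorem real_pexYO_gt (Mz nL : ℕ) (hL A : ℤ) {σ : ℤ} (hσ : σ = 1 ∨ σ = -1) :
    ∀ (c : V) (i : Fin 2) (σ₀ : ℤˣ), 1 - δ < (bondPercolation G q).real (linkIn (↑(RgO G φ Q c) : Set V) (Λ c k) (pexYO G φ Q Mz nL hL A σ i σ₀ c)) := by
  intro c i σ₀
  obtain ⟨hn, hh, hℓ, hR, hv⟩ := hQ c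
  have he : (σ₀ : ℤ) * σ = 1 ∨ (σ₀ : ℤ) * σ = -1 := by
    rcases Int.units_eq_one_or σ₀ with h | h <;> rcases hσ with h' | h' <;> simp [h, h']
  rw [coe_RgO_eq_regionNAt hn hh hℓ hR]
  unfold pexYO
  split_ifs
  · obtain ⟨fam, σ', τ', hp⟩ := pexLev_eq_pieceNAt (G := G) (φ := φ) hn hh hℓ hR hv nL hL A he
    rw [hp]; exact hserved c fam σ' τ'
  · obtain ⟨fam, σ', τ', hp⟩ := pexRaw_eq_pieceNAt (G := G) (φ := φ) hn hh hℓ hR hv Mz he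
    rw [hp]; exact hserved c fam σ' τ'

/-- **`hexit` for the root-frame table** from the served inputs at every centre. [cite: KozmaNitzan2024, §4 pp. 19–21] -/
theorem real_pexRO_gt (Mz : ℕ) (A : ℤ) {σ : ℤ} (hσ : σ = 1 ∨ σ = -1) :
    ∀ (c : V) (i : Fin 2) (σ₀ : ℤˣ), 1 - δ < (bondPercolation G q).real (linkIn (↑(RgO G φ Q c) : Set V) (Λ c k) (pexRO G φ Q Mz A σ i σ₀ c)) := by
  intro c i σ₀
  obtain ⟨hn, hh, hℓ, hR, hv⟩ := hQ c
  have he : (σ₀ : ℤ) * σ = 1 ∨ (σ₀ : ℤ) * σ = -1 := by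
    rcases Int.units_eq_one_or σ₀ with h | h <;> rcases hσ with h' | h' <;> simp [h, h']
  have he1 : (σ₀ : ℤ) = 1 ∨ (σ₀ : ℤ) = -1 := by rcases Int.units_eq_one_or σ₀ with h | h <;> simp [h]
  rw [coe_RgO_eq_regionNAt hn hh hℓ hR]
  unfold pexRO
  split_ifs
  · obtain ⟨fam, σ', τ', hp⟩ := pexRaw_eq_pieceNAt (G := G) (φ := φ) hn hh hℓ hR hv Mz he
    rw [hp]; exact hserved c fam σ' τ'
  · obtain ⟨fam, σ', τ', hp⟩ := pexLev_eq_pieceNAt (G := G) (φ := φ) hn hh hℓ hR hv 1 0 A he1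
    rw [hp]; exact hserved c fam σ' τ'

end Served

end Skelφ

end Summit.CriticalPhenomena.PercolationContinuityZ3.Theorems.Transplant

end
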